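import Literature.Topology.FourManifolds.StableNormalFrameManifold
import Literature.Topology.FourManifolds.AffineTubeLocal
import Literature.Topology.FourManifolds.FramedTubularNbhd
import Literature.Topology.FourManifolds.InteriorConnected
import Literature.Topology.Euclidean.InvarianceOfDomain
import Literature.AlgebraicTopology.SingularHomology.SphereComplement
import Literature.AlgebraicTopology.Homotopy.UnreducedSuspension
import Mathlib.Geometry.Manifold.WhitneyEmbedding
import HarnessLib

/-!
# A framed closed tube of a compact s-parallelisable manifold with boundary in a sphere

Pontryagin–Thom input for the Wu-class proof of Kosinski X.(3.1) (evenness of the intersection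
form of a `π`-manifold): **every compact s-parallelisable `C^∞` manifold `W` — over any real model
with corners (whose range is convex), in particular a manifold WITH BOUNDARY — admits a closed tube
`t : W × [0,1]ᴺ ↪ 𝕊ᵈ⁺ᴺ` (continuous, injective) whose open part `t (W° × (0,1)ᴺ)` over the
interior is open** (`exists_closedTube`; Hirsch, *Differential Topology* (1976), Ch. 4 Thm. 5.1
and §6 (tubular neighbourhoods of neat submanifolds / ∂-manifolds); Kervaire–Milnor 1963, proof
of Thm. 3.1 (the normal bundle of an s-parallelisable manifold is stably trivial);
Milnor–Stasheff 1974, §18 (the tube in `Sⁿ⁺ᵏ`)).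

Construction (all proved): Whitney-embed `e : W ↪ V = ℝᴬ` (Mathlib
`exists_embedding_euclidean_of_compact`, valid with boundary); take the smooth transverse normal
frame `ν` of the STABILISED embedding `w ↦ (e w, 0) ∈ V × ℝ^{d+1}`
(`StableNormalFrameManifold.lean`); the tube map `G (w, s) = (e w, 0) + ∑ sₖ νₖ w` is locally
injective at every point of the zero section, boundary points included
(`AffineTubeLocal.exists_injOn_tubeMap` in a convex half-ball chart), hence injective on
`W × B(0, ε)` (`FramedTubularNbhd.exists_injOn_prod_ball`); its restriction to
`W° × B(0, ε)` has open image by Brouwer's invariance of domain (`InvarianceOfDomain.lean`) in the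
interior charts; rescale the cube into `B(0, ε)` and map `V × ℝ^{d+1} ≅ ℝᵈ⁺ᴺ` into the sphere by
the inverse stereographic projection (`SphereComplement.sphereMinusPointHomeomorph`).

No named facts are introduced.

## References

* M. W. Hirsch, *Differential Topology*, GTM 33, Springer 1976, Ch. 4 Thm. 5.1, §6. [Hirsch1976]
* M. Kervaire, J. Milnor, *Groups of homotopy spheres I*, Ann. of Math. 77 (1963), §3.
  [KervaireMilnorAnnals1963]
* J. Milnor, J. Stasheff, *Characteristic classes*, Princeton UP 1974, §18. [MilnorStasheff1974]
-/

noncomputable section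

open scoped Manifold ContDiff Topology
open Set Function Metric Module Finset
open Literature.Topology.FourManifolds.StableNormalFrame Literature.Topology.FourManifolds.AffineTube
open Literature.AlgebraicTopology.Homotopy

namespace Literature.Topology.FourManifolds

namespace FramedTube

variable {E H : Type*} [NormedAddCommGroup E] [NormedSpace ℝ E] [FiniteDimensional ℝ E]
  [TopologicalSpace H] {I : ModelWithCorners ℝ E H}
  {W : Type*} [TopologicalSpace W] [ChartedSpace H W] [IsManifold I ∞ W]
  {V : Type*} [NormedAddCommGroup V] [InnerProductSpace ℝ V] [FiniteDimensional ℝ V]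
  {K : Type*} [Fintype K] {κ : Type*} [Fintype κ]

/-! ### Injective linear maps are bounded below -/

/-- An injective linear map between finite-dimensional normed spaces is bounded below. [folklore] -/
theorem exists_pos_bound_of_injective {P Q : Type*} [NormedAddCommGroup P] [NormedSpace ℝ P]
    [NormedAddCommGroup Q] [NormedSpace ℝ Q] [FiniteDimensional ℝ P] [FiniteDimensional ℝ Q]
    (L : P →ₗ[ℝ] Q) (hL : Injective L) : ∃ c > 0, ∀ v, c * ‖v‖ ≤ ‖L v‖ := by
  let e₀ : P ≃ₗ[ℝ] LinearMap.range L := LinearEquiv.ofInjective L hL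
  let e : P ≃L[ℝ] LinearMap.range L := e₀.toContinuousLinearEquiv
  refine ⟨(‖(e.symm : LinearMap.range L →L[ℝ] P)‖ + 1)⁻¹, by positivity, fun v => ?_⟩
  have h1 : ‖v‖ ≤ ‖(e.symm : LinearMap.range L →L[ℝ] P)‖ * ‖e v‖ := by
    have := (e.symm : LinearMap.range L →L[ℝ] P).le_opNorm (e v)
    rwa [show (e.symm : LinearMap.range L →L[ℝ] P) (e v) = v from e.symm_apply_apply v] at this
  have h2 : ‖e v‖ = ‖L v‖ := rfl
  rw [h2] at h1
  rw [inv_mul_le_iff₀ (by positivity)]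
  nlinarith [norm_nonneg (L v), norm_nonneg v]

/-! ### The tube map -/

variable (e : W → V) (ν : K → W → V × (κ → ℝ)) in
/-- **The tube map of the stabilised embedding**: `G (w, s) = (e w, 0) + ∑ₖ sₖ νₖ w`. [cite: Hirsch1976, Ch. 4 Thm. 5.1] -/
def tubeG (p : W × (K → ℝ)) : V × (κ → ℝ) :=
  ((e p.1, 0) : V × (κ → ℝ)) + ∑ k, p.2 k • ν k p.1

omit [NormedAddCommGroup E] [NormedSpace ℝ E] [FiniteDimensional ℝ E] [TopologicalSpace W]
  [FiniteDimensional ℝ V] in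
/-- In a chart `φ` the tube map is the affine tube map of the chart expressions. [folklore] -/
lemma tubeG_eq_tubeMap {E : Type*} (e : W → V) (ν : K → W → V × (κ → ℝ)) (φ : PartialEquiv W E)
    {w : W} (hw : w ∈ φ.source) (s : K → ℝ) :
    tubeG e ν (w, s) = tubeMap (fun x => ((e (φ.symm x), 0) : V × (κ → ℝ)))
      (fun k x => ν k (φ.symm x)) (φ w, s) := by
  simp only [tubeG, tubeMap, φ.left_inv hw]

omit [FiniteDimensional ℝ V] [Fintype κ] in
/-- The tube map is continuous. [folklore] -/
lemma continuous_tubeG {e : W → V} {ν : K → W → V × (κ → ℝ)} (he : Continuous e)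
    (hν : ∀ k, Continuous (ν k)) : Continuous (tubeG e ν) :=
  ((he.comp continuous_fst).prodMk continuous_const).add
    (continuous_finsetSum _ fun k _ =>
      ((continuous_apply k).comp continuous_snd).smul ((hν k).comp continuous_fst))

/-! ### Local injectivity at every point of the zero section (boundary points included) -/

/-- **The tube map is injective near every point of the zero section**, for a transverse smooth
frame (the range of a real model with corners is convex, so half-space charts are convex;
Hirsch 1976, Ch. 4 §6).
[cite: Hirsch1976, Ch. 4 Thm. 5.1] -/
theorem exists_nhds_injOn_tubeG {e : W → V}
    (he : ContMDiff I 𝓘(ℝ, V) ∞ e) {ν : K → W → V × (κ → ℝ)}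
    (hν : ∀ k, ContMDiff I 𝓘(ℝ, V × (κ → ℝ)) ∞ (ν k)) (w₀ : W)
    (htr : Injective fun p : E × (K → ℝ) =>
      (((mfderiv I 𝓘(ℝ, V) e w₀ : E →L[ℝ] V) p.1, 0) : V × (κ → ℝ)) + ∑ k, p.2 k • ν k w₀) :
    ∃ U ∈ 𝓝 ((w₀, 0) : W × (K → ℝ)), InjOn (tubeG e ν) U := by
  -- the chart at `w₀` and a convex half ball inside its target
  set φ := extChartAt I w₀ with hφ
  set x₀ : E := φ w₀ with hx₀
  have hx₀t : x₀ ∈ φ.target := mem_extChartAt_target w₀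
  have hx₀r : x₀ ∈ range I := extChartAt_target_subset_range w₀ hx₀t
  obtain ⟨ρ, hρ, hρt⟩ : ∃ ρ > 0, ball x₀ ρ ∩ range I ⊆ φ.target :=
    Metric.mem_nhdsWithin_iff.1 (extChartAt_target_mem_nhdsWithin w₀)
  set C : Set E := range I ∩ ball x₀ ρ with hC
  have hCc : Convex ℝ C := I.convex_range.inter (convex_ball x₀ ρ)
  have hx₀C : x₀ ∈ C := ⟨hx₀r, mem_ball_self hρ⟩
  have hCt : C ⊆ φ.target := fun x hx => hρt ⟨hx.2, hx.1⟩
  have hCU : UniqueDiffOn ℝ C := I.uniqueDiffOn.inter isOpen_ball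
  -- chart expressions and their smoothness on the target
  set f : E → V × (κ → ℝ) := fun x => ((e (φ.symm x), 0) : V × (κ → ℝ)) with hf
  set νc : K → E → V × (κ → ℝ) := fun k x => ν k (φ.symm x) with hνc
  have hsmooth_e : ContDiffOn ℝ ∞ (e ∘ φ.symm) φ.target := by
    have := (contMDiff_iff.1 he).2 w₀ (e w₀)
    simpa only [extChartAt_model_space_eq_id, PartialEquiv.refl_coe, PartialEquiv.refl_source,
      Function.id_comp, preimage_univ, inter_univ] using this
  have hsmooth_ν : ∀ k, ContDiffOn ℝ ∞ (ν k ∘ φ.symm) φ.target := by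
    intro k
    have := (contMDiff_iff.1 (hν k)).2 w₀ (ν k w₀)
    simpa only [extChartAt_model_space_eq_id, PartialEquiv.refl_coe, PartialEquiv.refl_source,
      Function.id_comp, preimage_univ, inter_univ] using this
  have h1le : (1 : WithTop ℕ∞) ≤ ∞ := by exact_mod_cast le_top
  have hfC : ContDiffOn ℝ 1 f C :=
    ((hsmooth_e.of_le h1le).prodMk contDiffOn_const).mono hCt
  have hνC : ∀ k, ContDiffOn ℝ 1 (νc k) C := fun k => ((hsmooth_ν k).of_le h1le).mono hCt
  -- derivatives within `C`
  set f' : E → E →L[ℝ] V × (κ → ℝ) := fun x => fderivWithin ℝ f C x with hf'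
  set ν' : K → E → E →L[ℝ] V × (κ → ℝ) := fun k x => fderivWithin ℝ (νc k) C x with hν'
  have hfd : ∀ x ∈ C, HasFDerivWithinAt f (f' x) C x := fun x hx =>
    ((hfC.differentiableOn one_ne_zero) x hx).hasFDerivWithinAt
  have hνd : ∀ k, ∀ x ∈ C, HasFDerivWithinAt (νc k) (ν' k x) C x := fun k x hx =>
    (((hνC k).differentiableOn one_ne_zero) x hx).hasFDerivWithinAt
  have hf'c : ContinuousOn f' C := hfC.continuousOn_fderivWithin hCU le_rfl
  have hνcc : ∀ k, ContinuousOn (νc k) C := fun k => (hνC k).continuousOn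
  have hν'c : ∀ k, ContinuousOn (ν' k) C := fun k => (hνC k).continuousOn_fderivWithin hCU le_rfl
  -- the derivative at the centre is `(de_{w₀}, 0)`, as a map of vector spaces
  let de : E →L[ℝ] V := mfderiv I 𝓘(ℝ, V) e w₀
  have hmf : HasFDerivWithinAt (e ∘ φ.symm) de (range I) x₀ := by
    have h := ((he w₀).mdifferentiableAt (by simp)).hasMFDerivAt.2
    simp only [writtenInExtChartAt, extChartAt_model_space_eq_id, PartialEquiv.refl_coe,
      Function.id_comp] at h
    exact h
  have hderiv : HasFDerivWithinAt f (de.prod (0 : E →L[ℝ] (κ → ℝ))) (range I) x₀ :=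
    hmf.prodMk (hasFDerivWithinAt_const _ _ _)
  have hf'x₀ : f' x₀ = de.prod (0 : E →L[ℝ] (κ → ℝ)) := by
    rw [hf']
    change fderivWithin ℝ f (range I ∩ ball x₀ ρ) x₀ = _
    rw [fderivWithin_inter (ball_mem_nhds x₀ hρ)]
    exact hderiv.fderivWithin (I.uniqueDiffOn x₀ hx₀r)
  have hνx₀ : ∀ k, νc k x₀ = ν k w₀ := fun k => by
    change ν k (φ.symm (φ w₀)) = ν k w₀; rw [extChartAt_to_inv]
  -- transversality gives the lower bound
  obtain ⟨c, hc, hbelow⟩ : ∃ c > 0, ∀ (v : E) (σ : K → ℝ),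
      c * ‖(v, σ)‖ ≤ ‖f' x₀ v + ∑ k, σ k • νc k x₀‖ := by
    let L : (E × (K → ℝ)) →L[ℝ] V × (κ → ℝ) :=
      (de.prod (0 : E →L[ℝ] (κ → ℝ))).comp (ContinuousLinearMap.fst ℝ E (K → ℝ)) +
        ∑ k, ((ContinuousLinearMap.proj k).comp (ContinuousLinearMap.snd ℝ E (K → ℝ))).smulRight
          (ν k w₀)
    have hL : ∀ (v : E) (σ : K → ℝ), L (v, σ) = ((de v, 0) : V × (κ → ℝ)) + ∑ k, σ k • ν k w₀ := by
      intro v σ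
      simp [L]
    have hLinj : Injective L := by
      rintro ⟨v, σ⟩ ⟨v', σ'⟩ h
      have h' : L (v, σ) = L (v', σ') := h
      rw [hL, hL] at h'
      exact htr h'
    obtain ⟨c, hc, hcb⟩ := exists_pos_bound_of_injective L.toLinearMap hLinj
    refine ⟨c, hc, fun v σ => ?_⟩
    have := hcb (v, σ)
    have e1 : f' x₀ v + ∑ k, σ k • νc k x₀ = L (v, σ) := by
      rw [hL, hf'x₀]
      simp only [hνx₀, ContinuousLinearMap.prod_apply]
      rfl
    rw [e1]
    exact this
  obtain ⟨r, hr, hinj⟩ := exists_injOn_tubeMap hCc hfd hνd hf'c hνcc hν'c hx₀C hc hbelow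
  -- pull the injectivity back to `W × ℝ^K`
  set U : Set (W × (K → ℝ)) :=
    {p | p.1 ∈ φ.source ∧ φ p.1 ∈ ball x₀ (min ρ r) ∧ p.2 ∈ ball (0 : K → ℝ) r} with hU
  have hUn : U ∈ 𝓝 ((w₀, 0) : W × (K → ℝ)) := by
    have h1 : {w : W | w ∈ φ.source} ∈ 𝓝 w₀ := extChartAt_source_mem_nhds w₀
    have h2 : {w : W | φ w ∈ ball x₀ (min ρ r)} ∈ 𝓝 w₀ :=
      (continuousAt_extChartAt w₀).preimage_mem_nhds (ball_mem_nhds _ (lt_min hρ hr))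
    have h3 : ball (0 : K → ℝ) r ∈ 𝓝 (0 : K → ℝ) := ball_mem_nhds _ hr
    have := prod_mem_nhds (Filter.inter_mem h1 h2) h3
    exact Filter.mem_of_superset this fun p hp => ⟨hp.1.1, hp.1.2, hp.2⟩
  refine ⟨U, hUn, ?_⟩
  rintro ⟨w, s⟩ ⟨hws, hwb, hs⟩ ⟨w', s'⟩ ⟨hws', hwb', hs'⟩ hG
  have hmem : ∀ {w : W} {s : K → ℝ}, w ∈ φ.source → φ w ∈ ball x₀ (min ρ r) → s ∈ ball (0 : K → ℝ) r →
      ((φ w, s) : E × (K → ℝ)) ∈ (C ∩ ball x₀ r) ×ˢ ball (0 : K → ℝ) r := by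
    intro w s hws hwb hs
    have hb := mem_ball.1 hwb
    exact ⟨⟨⟨extChartAt_target_subset_range w₀ (φ.map_source hws),
      mem_ball.2 (lt_of_lt_of_le hb (min_le_left _ _))⟩,
      mem_ball.2 (lt_of_lt_of_le hb (min_le_right _ _))⟩, hs⟩
  rw [tubeG_eq_tubeMap e ν φ hws, tubeG_eq_tubeMap e ν φ hws'] at hG
  have key := hinj (hmem hws hwb hs) (hmem hws' hwb' hs') hG
  simp only [Prod.mk.injEq] at key
  exact Prod.ext (φ.injOn hws hws' key.1) key.2

/-! ### The open tube over the interior is open (invariance of domain) -/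

/-- **The image of `W° × B(0, ε')` under an injective tube map is open** (`ε' ≤ ε`, injectivity
on `W × B(0, ε)`): Brouwer's invariance of domain in the interior charts. [cite: Hirsch1976, Ch. 4 Thm. 5.1] -/
theorem isOpen_image_tubeG_interior {e : W → V} (he : ContMDiff I 𝓘(ℝ, V) ∞ e)
    {ν : K → W → V × (κ → ℝ)} (hν : ∀ k, ContMDiff I 𝓘(ℝ, V × (κ → ℝ)) ∞ (ν k))
    (hdim : finrank ℝ E + Fintype.card K = finrank ℝ V + Fintype.card κ) {ε ε' : ℝ}
    (hε' : ε' ≤ ε) (hinj : InjOn (tubeG e ν) ((univ : Set W) ×ˢ ball (0 : K → ℝ) ε)) :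
    IsOpen (tubeG e ν '' ((I.interior W) ×ˢ ball (0 : K → ℝ) ε')) := by
  have hcont : Continuous (tubeG e ν) :=
    continuous_tubeG he.continuous fun k => (hν k).continuous
  rw [isOpen_iff_forall_mem_open]
  rintro _ ⟨⟨w₀, s₀⟩, ⟨hw₀, hs₀⟩, rfl⟩
  -- the chart at the interior point `w₀`
  set φ := extChartAt I w₀ with hφ
  set x₀ : E := φ w₀ with hx₀
  have hx₀i : x₀ ∈ interior (range I) :=
    (isInteriorPoint_iff_extChartAt_mem_interior_range (I := I) (mem_extChartAt_source w₀)).1 hw₀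
  obtain ⟨ρ₁, hρ₁, hρ₁t⟩ : ∃ ρ > 0, ball x₀ ρ ∩ range I ⊆ φ.target :=
    Metric.mem_nhdsWithin_iff.1 (extChartAt_target_mem_nhdsWithin w₀)
  obtain ⟨ρ₂, hρ₂, hρ₂i⟩ : ∃ ρ > 0, ball x₀ ρ ⊆ interior (range I) :=
    Metric.isOpen_iff.1 isOpen_interior x₀ hx₀i
  set ρ := min ρ₁ ρ₂ with hρ
  have hρpos : 0 < ρ := lt_min hρ₁ hρ₂
  have hballi : ball x₀ ρ ⊆ interior (range I) := (ball_subset_ball (min_le_right _ _)).trans hρ₂i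
  have hballt : ball x₀ ρ ⊆ φ.target := fun x hx =>
    hρ₁t ⟨ball_subset_ball (min_le_left _ _) hx, interior_subset (hballi hx)⟩
  -- the chart expression of the tube map on an open box
  set O : Set (E × (K → ℝ)) := ball x₀ ρ ×ˢ ball (0 : K → ℝ) ε' with hO
  have hOo : IsOpen O := isOpen_ball.prod isOpen_ball
  set Λ : E × (K → ℝ) → V × (κ → ℝ) := fun q => tubeG e ν (φ.symm q.1, q.2) with hΛ
  have hΛc : ContinuousOn Λ O := by
    refine hcont.comp_continuousOn ?_
    exact ((continuousOn_extChartAt_symm w₀).comp continuous_fst.continuousOn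
      fun q hq => hballt hq.1).prodMk continuous_snd.continuousOn
  have hΛi : InjOn Λ O := by
    rintro ⟨x, s⟩ ⟨hx, hs⟩ ⟨x', s'⟩ ⟨hx', hs'⟩ hxx'
    have key := hinj ⟨mem_univ _, ball_subset_ball hε' hs⟩ ⟨mem_univ _, ball_subset_ball hε' hs'⟩ hxx'
    simp only [Prod.mk.injEq] at key
    exact Prod.ext (φ.symm.injOn (hballt hx) (hballt hx') key.1) key.2
  have hopen : IsOpen (Λ '' O) :=
    Literature.Topology.Euclidean.Brouwer.isOpen_image_of_injOn (by
      rw [Module.finrank_prod, Module.finrank_prod, Module.finrank_fintype_fun_eq_card,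
        Module.finrank_fintype_fun_eq_card, hdim]) hOo hΛc hΛi
  refine ⟨Λ '' O, ?_, hopen, ⟨(x₀, s₀), ⟨mem_ball_self hρpos, hs₀⟩, ?_⟩⟩
  · rintro _ ⟨⟨x, s⟩, ⟨hx, hs⟩, rfl⟩
    refine ⟨(φ.symm x, s), ⟨?_, hs⟩, rfl⟩
    -- `φ.symm x` is an interior point
    have hxs : φ.symm x ∈ φ.source := φ.map_target (hballt hx)
    refine (isInteriorPoint_iff_extChartAt_mem_interior_range (I := I) hxs).2 ?_
    rw [φ.right_inv (hballt hx)]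
    exact hballi hx
  · change tubeG e ν (φ.symm (φ w₀), s₀) = tubeG e ν (w₀, s₀)
    rw [extChartAt_to_inv]

/-! ### Rescaling the cube into a small ball -/

/-- The affine rescaling `θ ↦ (ε (2θₖ − 1) / 2)ₖ` of the unit cube. [folklore] -/
def rescale (ε : ℝ) (θ : K → unitInterval) : K → ℝ := fun k => ε * (2 * (θ k : ℝ) - 1) / 2

omit [Fintype K] in
/-- `rescale` is continuous. [folklore] -/
lemma continuous_rescale (ε : ℝ) : Continuous (rescale (K := K) ε) :=
  continuous_pi fun k => ((continuous_const.mul ((continuous_const.mul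
    (continuous_subtype_val.comp (continuous_apply k))).sub continuous_const)).div_const _)

omit [Fintype K] in
/-- `rescale` is injective for `ε ≠ 0`. [folklore] -/
lemma rescale_injective {ε : ℝ} (hε : ε ≠ 0) : Injective (rescale (K := K) ε) := by
  intro θ θ' h
  funext k
  have := congrFun h k
  simp only [rescale] at this
  apply Subtype.ext
  have h2 : ε * (2 * (θ k : ℝ) - 1) = ε * (2 * (θ' k : ℝ) - 1) := by linarith
  have h3 := mul_left_cancel₀ hε h2
  linarith

/-- The closed cube goes into the ball of radius `ε`. [folklore] -/
lemma rescale_mem_ball {ε : ℝ} (hε : 0 < ε) (θ : K → unitInterval) :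
    rescale ε θ ∈ ball (0 : K → ℝ) ε := by
  rw [mem_ball_zero_iff, pi_norm_lt_iff hε]
  intro k
  rw [Real.norm_eq_abs, abs_lt]
  have h0 := (θ k).2.1; have h1 := (θ k).2.2
  simp only [rescale]
  constructor <;> nlinarith

/-- **The open cube goes onto the open ball of radius `ε/2`** (sup norm). [folklore] -/
lemma rescale_image_openCube {ε : ℝ} (hε : 0 < ε) :
    rescale ε '' (Set.pi univ fun _ : K => Susp.midHeights) = ball (0 : K → ℝ) (ε / 2) := by
  ext s
  constructor
  · rintro ⟨θ, hθ, rfl⟩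
    rw [mem_ball_zero_iff, pi_norm_lt_iff (by positivity)]
    intro k
    have hk := hθ k (mem_univ k)
    change (0 : ℝ) < θ k ∧ (θ k : ℝ) < 1 at hk
    rw [Real.norm_eq_abs, abs_lt]
    simp only [rescale]
    constructor <;> nlinarith [hk.1, hk.2]
  · intro hs
    rw [mem_ball_zero_iff, pi_norm_lt_iff (by positivity)] at hs
    refine ⟨fun k => ⟨(s k / ε + 1 / 2), ?_, ?_⟩, fun k _ => ?_, ?_⟩
    · have := (abs_lt.1 (by simpa [Real.norm_eq_abs] using hs k))
      have h1 : -(1/2 : ℝ) < s k / ε := by rw [lt_div_iff₀ hε]; linarith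
      linarith
    · have := (abs_lt.1 (by simpa [Real.norm_eq_abs] using hs k))
      have h1 : s k / ε < 1/2 := by rw [div_lt_iff₀ hε]; linarith
      linarith
    · have := (abs_lt.1 (by simpa [Real.norm_eq_abs] using hs k))
      have h1 : -(1/2 : ℝ) < s k / ε := by rw [lt_div_iff₀ hε]; linarith
      have h2 : s k / ε < 1/2 := by rw [div_lt_iff₀ hε]; linarith
      change (0 : ℝ) < s k / ε + 1 / 2 ∧ s k / ε + 1 / 2 < 1
      constructor <;> linarith
    · funext k
      simp only [rescale]
      field_simp
      ring

/-! ### Into the sphere -/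

/-- **An open embedding of `ℝᵐ` into `𝕊ᵐ`** (inverse stereographic projection from a point;
the tree's `sphereMinusPointHomeomorph`). [folklore] -/
theorem exists_isOpenEmbedding_euclidean_sphere (m : ℕ) :
    ∃ ψ : EuclideanSpace ℝ (Fin m) → Metric.sphere (0 : EuclideanSpace ℝ (Fin (m + 1))) 1,
      Topology.IsOpenEmbedding ψ := by
  let v : Metric.sphere (0 : EuclideanSpace ℝ (Fin (m + 1))) 1 :=
    ⟨EuclideanSpace.single (0 : Fin (m + 1)) 1, by simp⟩
  let h := Literature.AlgebraicTopology.SingularHomology.SphereComplement.sphereMinusPointHomeomorph v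
  refine ⟨Subtype.val ∘ h.symm, ?_⟩
  exact (isOpen_compl_singleton.isOpenEmbedding_subtypeVal).comp h.symm.isOpenEmbedding

/-! ### The closed tube -/

/-- **A framed closed tube of a compact s-parallelisable manifold (with boundary) in a sphere**
(Hirsch 1976, Ch. 4 Thm. 5.1 and §6; Kervaire–Milnor 1963, proof of Thm. 3.1; Milnor–Stasheff
1974, §18): for `W` compact over a real model with corners `I` (e.g. `𝓡∂ d`, boundary allowed)
and s-parallelisable, `dim E = d`, there are `N` and a continuous injective
`t : W × [0,1]ᴺ → 𝕊ᵈ⁺ᴺ` such that `t (W° × (0,1)ᴺ)` is open. See the module docstring.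
[cite: Hirsch1976, Ch. 4 Thm. 5.1] -/
theorem exists_closedTube [T2Space W] [CompactSpace W] (d : ℕ) (hd : finrank ℝ E = d)
    (hW : IsStablyParallelizable I W) :
    ∃ (N : ℕ) (t : W × (Fin N → unitInterval) →
        Metric.sphere (0 : EuclideanSpace ℝ (Fin (d + N + 1))) 1),
      Continuous t ∧ Injective t ∧
        IsOpen (t '' ((I.interior W) ×ˢ (Set.pi univ fun _ : Fin N => Susp.midHeights))) := by
  classical
  -- Whitney embedding (valid with boundary)
  obtain ⟨A, e, he, hemb, hde⟩ := exists_embedding_euclidean_of_compact (I := I) (M := W)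
  -- the smooth transverse normal frame of the stabilised embedding
  obtain ⟨ν, hν, htr⟩ := exists_smooth_transverse_normalFrame he hde hW
  -- global injectivity on a uniform ball
  have hcont : Continuous (tubeG e ν) := continuous_tubeG he.continuous fun k => (hν k).continuous
  have h0 : Injective fun w : W => tubeG e ν (w, 0) := by
    intro w w' h
    simp only [tubeG, Pi.zero_apply, zero_smul, Finset.sum_const_zero, add_zero, Prod.mk.injEq] at h
    exact hemb.injective h.1
  have hloc : ∀ w : W, ∃ U ∈ 𝓝 (w, (0 : Fin (finrank ℝ (EuclideanSpace ℝ (Fin A)) + 1) → ℝ)),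
      InjOn (tubeG e ν) U := fun w => exists_nhds_injOn_tubeG he hν w (htr w)
  obtain ⟨ε, hε, hinj⟩ := exists_injOn_prod_ball hcont h0 hloc
  -- the closed tube in `V × ℝ^κ`
  set t₀ : W × (Fin (finrank ℝ (EuclideanSpace ℝ (Fin A)) + 1) → unitInterval) →
      EuclideanSpace ℝ (Fin A) × (Fin (finrank ℝ E + 1) → ℝ) :=
    fun p => tubeG e ν (p.1, rescale ε p.2) with ht₀
  have ht₀c : Continuous t₀ :=
    hcont.comp (continuous_fst.prodMk ((continuous_rescale ε).comp continuous_snd))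
  have ht₀i : Injective t₀ := by
    rintro ⟨w, θ⟩ ⟨w', θ'⟩ h
    have key := hinj ⟨mem_univ _, rescale_mem_ball hε θ⟩ ⟨mem_univ _, rescale_mem_ball hε θ'⟩ h
    simp only [Prod.mk.injEq] at key
    exact Prod.ext key.1 (rescale_injective hε.ne' key.2)
  have hdim : finrank ℝ E + Fintype.card (Fin (finrank ℝ (EuclideanSpace ℝ (Fin A)) + 1)) =
      finrank ℝ (EuclideanSpace ℝ (Fin A)) + Fintype.card (Fin (finrank ℝ E + 1)) := by
    rw [Fintype.card_fin, Fintype.card_fin]; ring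
  have ht₀o : IsOpen (t₀ '' ((I.interior W) ×ˢ
      (Set.pi univ fun _ : Fin (finrank ℝ (EuclideanSpace ℝ (Fin A)) + 1) => Susp.midHeights))) := by
    have himg : t₀ '' ((I.interior W) ×ˢ
        (Set.pi univ fun _ : Fin (finrank ℝ (EuclideanSpace ℝ (Fin A)) + 1) => Susp.midHeights)) =
        tubeG e ν '' ((I.interior W) ×ˢ
          ball (0 : Fin (finrank ℝ (EuclideanSpace ℝ (Fin A)) + 1) → ℝ) (ε / 2)) := by
      rw [← rescale_image_openCube hε]
      ext y
      constructor
      · rintro ⟨⟨w, θ⟩, ⟨hw, hθ⟩, rfl⟩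
        exact ⟨(w, rescale ε θ), ⟨hw, θ, hθ, rfl⟩, rfl⟩
      · rintro ⟨⟨w, _⟩, ⟨hw, θ, hθ, rfl⟩, rfl⟩
        exact ⟨(w, θ), ⟨hw, hθ⟩, rfl⟩
    rw [himg]
    exact isOpen_image_tubeG_interior he hν hdim (by linarith) hinj
  -- into `ℝ^{dim E + N}` and then into the sphere
  have hfin : finrank ℝ (EuclideanSpace ℝ (Fin A) × (Fin (finrank ℝ E + 1) → ℝ)) =
      finrank ℝ (EuclideanSpace ℝ (Fin (d + (finrank ℝ (EuclideanSpace ℝ (Fin A)) + 1)))) := by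
    rw [Module.finrank_prod, Module.finrank_fintype_fun_eq_card, Fintype.card_fin,
      finrank_euclideanSpace_fin, finrank_euclideanSpace_fin, hd]
    ring
  let Φ : (EuclideanSpace ℝ (Fin A) × (Fin (finrank ℝ E + 1) → ℝ)) ≃L[ℝ]
      EuclideanSpace ℝ (Fin (d + (finrank ℝ (EuclideanSpace ℝ (Fin A)) + 1))) :=
    ContinuousLinearEquiv.ofFinrankEq hfin
  obtain ⟨ψ, hψ⟩ := exists_isOpenEmbedding_euclidean_sphere
    (d + (finrank ℝ (EuclideanSpace ℝ (Fin A)) + 1))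
  refine ⟨finrank ℝ (EuclideanSpace ℝ (Fin A)) + 1, ψ ∘ Φ ∘ t₀,
    hψ.continuous.comp (Φ.continuous.comp ht₀c), hψ.injective.comp (Φ.injective.comp ht₀i), ?_⟩
  rw [Set.image_comp, Set.image_comp]
  exact hψ.isOpenMap _ (Φ.toHomeomorph.isOpenMap _ ht₀o)

end FramedTube

end Literature.Topology.FourManifolds
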